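import Mathlib
import Summits.ValiantsHypothesis.ValiantsHypothesis.Theorems.LiouvilleSarnakLiouvilleCutRankSwapStability
import Summits.ValiantsHypothesis.ValiantsHypothesis.Theorems.LiouvilleSarnakLiouvilleCutRankDefectiveWindow
import Summits.ValiantsHypothesis.ValiantsHypothesis.Theorems.LiouvilleSarnakLiouvilleCutRankCutRelabel

/-!
# Route LiouvilleSarnak — crux `LiouvilleCutRank` (stmt-ValiantsHypothesis-14775):
# `log₄ rank` is 1-Lipschitz in the Hamming distance between cut words

For two cuts `π, π'` of the same `2n` bit positions let `D(π, π')` be the number of row positions of `π`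
that are column positions of `π'` (half the Hamming distance between the two row/column words; by
balance it is symmetric).  Combining `…SwapStability` (one row/column swap costs a factor `≤ 4`),
`…DefectiveWindow` §1 (swap lists with distinct indices act in parallel) and `…CutRelabel` (cuts with the
same row-position SET have equal rank):

* `card_rowsNotRows_eq` — `D(π, π') = D(π', π)`.
* ★ `rank_le_pow_card_mul_rank` — **`rank M_π ≤ 4^{D(π,π')} · rank M_{π'}`** for ANY two cuts at one level.
  (Pair the `D` row indices of `π` sitting at column positions of `π'` with the `D` column indices of `π`
  sitting at row positions of `π'`; after these swaps the row-position set is that of `π'`.)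
* ★ `eventually_le_rank_of_near` — HAMMING-BALL CLOSURE: if the cuts with a property `P` have Liouville
  cut-matrix rank `→ ∞` uniformly in the level, then so do all cuts within distance `D ≤ d` of a cut with
  `P` at the same level, for every fixed `d`.

So every unconditional class of the OPEN crux (aligned windows, near-aligned, `(CR)^n`, certified periodic
patterns, `W ≤ 64`, …) is automatically a class of Hamming balls of any fixed radius, and a counterexample
family to the crux (rank `< W` at infinitely many levels) stays a counterexample family (rank `< 4^d W`) under
`d` arbitrary letter exchanges per level.  Honest framing: radius fixed while the level grows;
`LiouvilleCutRank`, `DigitalBilinearLiouville`, `AlgebraicSarnak` stay OPEN; nothing bears on `VP ≠ VNP`.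
No definitions.
-/

set_option linter.dupNamespace false

noncomputable section

namespace Summit.ValiantsHypothesis.ValiantsHypothesis.Theorems.LiouvilleSarnakLiouvilleCutRank.HammingBall

open ArithmeticFunction Finset

open Summit.ValiantsHypothesis.ValiantsHypothesis.Theorems.LiouvilleSarnakLiouvilleCutRank.SwapStability
  (rank_le_pow_mul_rank_swaps)
open Summit.ValiantsHypothesis.ValiantsHypothesis.Theorems.LiouvilleSarnakLiouvilleCutRank.DefectiveWindow
  (foldr_swaps_apply_inl_of_not_mem foldr_swaps_apply_of_mem)
open Summit.ValiantsHypothesis.ValiantsHypothesis.Theorems.LiouvilleSarnakLiouvilleCutRank.CutRelabel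
  (rank_cutMatrix_eq_of_range_inl_eq)

/-! ### §1 Counting row positions -/

/-- A cut has exactly `n` row positions. [folklore] -/
theorem card_rowPositions {n : ℕ} (π : Fin n ⊕ Fin n ≃ Fin (2 * n)) :
    (univ.image fun i : Fin n => π (Sum.inl i)).card = n := by
  have hinj : Function.Injective (fun i : Fin n => π (Sum.inl i)) :=
    π.injective.comp Sum.inl_injective
  rw [card_image_of_injective _ hinj, card_univ, Fintype.card_fin]

/-- A position that is not a row position is a column position. [folklore] -/
theorem exists_inr_of_not_mem_rowPositions {n : ℕ} (π : Fin n ⊕ Fin n ≃ Fin (2 * n)) (k : Fin (2 * n))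
    (hk : k ∉ univ.image fun i : Fin n => π (Sum.inl i)) : ∃ j : Fin n, π (Sum.inr j) = k := by
  rcases hx : π.symm k with i | j
  · exact absurd (mem_image.mpr ⟨i, mem_univ _, by rw [← hx, Equiv.apply_symm_apply]⟩) hk
  · exact ⟨j, by rw [← hx, Equiv.apply_symm_apply]⟩

/-- The distance is symmetric: as many row positions of `π` are column positions of `π'` as conversely.
[folklore] -/
theorem card_rowsNotRows_eq {n : ℕ} (π π' : Fin n ⊕ Fin n ≃ Fin (2 * n)) :
    ((univ.image fun i : Fin n => π (Sum.inl i)) \ (univ.image fun i : Fin n => π' (Sum.inl i))).card =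
      ((univ.image fun i : Fin n => π' (Sum.inl i)) \ (univ.image fun i : Fin n => π (Sum.inl i))).card :=
  card_sdiff_comm (by rw [card_rowPositions, card_rowPositions])

/-! ### §2 The Lipschitz bound -/

/-- ★ **`rank M_π ≤ 4^{D(π,π')} · rank M_{π'}`** for any two cuts of the same `2n` positions, where
`D(π, π')` is the number of row positions of `π` that are not row positions of `π'`. [this file] -/
theorem rank_le_pow_card_mul_rank {n : ℕ} (π π' : Fin n ⊕ Fin n ≃ Fin (2 * n)) :
    (Matrix.of fun r c : Fin n → Bool =>
      (((liouville (Nat.ofBits (fun k : Fin (2 * n) => Sum.elim r c (π.symm k)) + 1) : ℤ) : ℂ))).rank ≤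
    4 ^ ((univ.image fun i : Fin n => π (Sum.inl i)) \ (univ.image fun i : Fin n => π' (Sum.inl i))).card *
    (Matrix.of fun r c : Fin n → Bool =>
      (((liouville (Nat.ofBits (fun k : Fin (2 * n) => Sum.elim r c (π'.symm k)) + 1) : ℤ) : ℂ))).rank := by
  classical
  set R := univ.image fun i : Fin n => π (Sum.inl i) with hR
  set R' := univ.image fun i : Fin n => π' (Sum.inl i) with hR'
  -- row indices of `π` to move out, column indices of `π` to move in
  set Is := univ.filter fun i : Fin n => π (Sum.inl i) ∉ R' with hIs
  set Js := univ.filter fun j : Fin n => π (Sum.inr j) ∈ R' with hJs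
  have hIcard : Is.card = (R \ R').card := by
    have himg : R \ R' = Is.image fun i : Fin n => π (Sum.inl i) := by
      ext k
      simp only [mem_sdiff, hR, hIs, mem_image, mem_filter, mem_univ, true_and]
      constructor
      · rintro ⟨⟨i, rfl⟩, hk⟩; exact ⟨i, hk, rfl⟩
      · rintro ⟨i, hi, rfl⟩; exact ⟨⟨i, rfl⟩, hi⟩
    have hinj : Function.Injective (fun i : Fin n => π (Sum.inl i)) :=
      π.injective.comp Sum.inl_injective
    rw [himg, card_image_of_injective _ hinj]
  have hJcard : Js.card = (R' \ R).card := by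
    have himg : R' \ R = Js.image fun j : Fin n => π (Sum.inr j) := by
      ext k
      simp only [mem_sdiff, hJs, mem_image, mem_filter, mem_univ, true_and]
      constructor
      · rintro ⟨hk', hk⟩
        obtain ⟨j, rfl⟩ := exists_inr_of_not_mem_rowPositions π k hk
        exact ⟨j, hk', rfl⟩
      · rintro ⟨j, hj, rfl⟩
        refine ⟨hj, fun hmem => ?_⟩
        obtain ⟨i, -, hi⟩ := mem_image.mp hmem
        exact Sum.inl_ne_inr (π.injective hi)
    have hinj : Function.Injective (fun j : Fin n => π (Sum.inr j)) :=
      π.injective.comp Sum.inr_injective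
    rw [himg, card_image_of_injective _ hinj]
  have hIJ : Is.card = Js.card := by rw [hIcard, hJcard, card_rowsNotRows_eq]
  -- the swap list
  set Lw : List (Fin n × Fin n) := Is.toList.zip Js.toList with hLw
  have hlen1 : Is.toList.length = Js.toList.length := by rw [length_toList, length_toList, hIJ]
  have hfst : Lw.map Prod.fst = Is.toList := by
    rw [hLw]; exact List.map_fst_zip (le_of_eq hlen1)
  have hsnd : Lw.map Prod.snd = Js.toList := by
    rw [hLw]; exact List.map_snd_zip (le_of_eq hlen1.symm)
  have h1 : (Lw.map Prod.fst).Nodup := by rw [hfst]; exact nodup_toList _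
  have h2 : (Lw.map Prod.snd).Nodup := by rw [hsnd]; exact nodup_toList _
  have hlen : Lw.length = (R \ R').card := by
    rw [hLw, List.length_zip, hlen1, min_self, length_toList, hJcard, card_rowsNotRows_eq]
  set π₀ := Lw.foldr (fun q e => (Equiv.swap (Sum.inl q.1) (Sum.inr q.2)).trans e) π with hπ₀
  -- after the swaps the row positions are those of `π'`
  have hsub : (univ.image fun i : Fin n => π₀ (Sum.inl i)) ⊆ R' := by
    intro k hk
    obtain ⟨i, -, rfl⟩ := mem_image.mp hk
    by_cases hi : i ∈ Lw.map Prod.fst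
    · obtain ⟨q, hq, hqi⟩ := List.mem_map.mp hi
      have hmem : (i, q.2) ∈ Lw := by rw [← hqi]; exact hq
      rw [hπ₀, (foldr_swaps_apply_of_mem π Lw h1 h2 i q.2 hmem).1]
      have hj : q.2 ∈ Js := by
        rw [← mem_toList, ← hsnd]
        exact List.mem_map.mpr ⟨q, hq, rfl⟩
      exact (mem_filter.mp hj).2
    · rw [hπ₀, foldr_swaps_apply_inl_of_not_mem π Lw i hi]
      have hi' : i ∉ Is := by rwa [← mem_toList, ← hfst]
      rw [hIs, mem_filter, not_and] at hi'
      exact not_not.mp (hi' (mem_univ _))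
  have heq : (univ.image fun i : Fin n => π₀ (Sum.inl i)) = R' :=
    eq_of_subset_of_card_le hsub (by rw [hR', card_rowPositions, card_rowPositions])
  have hrange : Set.range (fun i : Fin n => π' (Sum.inl i)) = Set.range (fun i : Fin n => π₀ (Sum.inl i)) := by
    rw [← Set.image_univ, ← Set.image_univ, ← coe_univ, ← coe_image, ← coe_image, heq]
  have hrank := rank_cutMatrix_eq_of_range_inl_eq n π' π₀ hrange
  -- assemble
  have hle := rank_le_pow_mul_rank_swaps
    (fun v : Fin (2 * n) → Bool => (((liouville (Nat.ofBits v + 1)) : ℤ) : ℂ)) π Lw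
  rw [hlen] at hle
  simpa only [← hπ₀, hrank] using hle

/-! ### §3 Hamming-ball closure of unconditional classes -/

/-- ★ **Hamming-ball closure.**  If the cuts with a property `P` have Liouville cut-matrix rank `→ ∞`
uniformly in the level, then so do all cuts `π` at distance `D(π, π') ≤ d` from a cut `π'` with `P` at the
same level, for every fixed `d`. [this file] -/
theorem eventually_le_rank_of_near
    (P : ∀ n : ℕ, (Fin n ⊕ Fin n ≃ Fin (2 * n)) → Prop)
    (h : ∀ W : ℕ, ∃ n₀ : ℕ, ∀ n ≥ n₀, ∀ π' : Fin n ⊕ Fin n ≃ Fin (2 * n), P n π' →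
      W ≤ (Matrix.of fun r c : Fin n → Bool =>
        (((liouville (Nat.ofBits (fun k : Fin (2 * n) => Sum.elim r c (π'.symm k)) + 1) : ℤ) : ℂ))).rank)
    (d W : ℕ) : ∃ n₀ : ℕ, ∀ n ≥ n₀, ∀ π π' : Fin n ⊕ Fin n ≃ Fin (2 * n), P n π' →
      ((univ.image fun i : Fin n => π (Sum.inl i)) \ (univ.image fun i : Fin n => π' (Sum.inl i))).card ≤ d →
      W ≤ (Matrix.of fun r c : Fin n → Bool =>
        (((liouville (Nat.ofBits (fun k : Fin (2 * n) => Sum.elim r c (π.symm k)) + 1) : ℤ) : ℂ))).rank := by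
  obtain ⟨n₀, hn₀⟩ := h (4 ^ d * W)
  refine ⟨n₀, fun n hn π π' hP hd => ?_⟩
  have h1 := hn₀ n hn π' hP
  have h2 := rank_le_pow_card_mul_rank π' π
  rw [card_rowsNotRows_eq] at h2
  have h3 : 4 ^ ((univ.image fun i : Fin n => π (Sum.inl i)) \
      (univ.image fun i : Fin n => π' (Sum.inl i))).card ≤ 4 ^ d :=
    Nat.pow_le_pow_right (by norm_num) hd
  exact Nat.le_of_mul_le_mul_left (h1.trans (h2.trans (Nat.mul_le_mul_right _ h3))) (by positivity)

end Summit.ValiantsHypothesis.ValiantsHypothesis.Theorems.LiouvilleSarnakLiouvilleCutRank.HammingBall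

end
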